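import Summits.QuantumFields.YangMills.Theorems.LuscherReductionTwistedTraceScalingInnerTwoZone
import Summits.QuantumFields.YangMills.Theorems.LuscherReductionTwistedTraceScalingShellOneOrbit
import HarnessLib

/-!
# THE LATTICE WINDOW FLOOR W(L): the `k`-UNIFORM and LOG-RATE target texts of its brick chain
# (lane A of S-BASE, crux `TwistedTraceScaling` stmt-QuantumFields-20203, line «twolattice», stub `stub_fixedLatticeTraceLaw`; lead g24;
# card `pub/ym-fleet/ym-luscher-20007-p1/Lines-window-floor.md`)

With COARSE-UPPER(L) (✓`ConstTube.coarseUpper`) and COARSE-LOWER(L) (✓`ConstTube.coarseLower`) in the tree, the registered stub S-BASE is closed by ✓`Base.stmt_of_window`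
MODULO the `k`-UNIFORM lattice window floor W(L), `L ≥ 2`.  W(L) is NOT a corollary of the per-level chain: `k` enters that chain in its three endgames (crux ONE per level), and the
gain texts `ValleyGainAt` / `InnerShellGainSmallAt` (`∀ A, ∃ β₀`) carry no rate (cdisprove R72), whereas W counts levels up to femto energy `c₁ log β` at ONE threshold `β₀`.
This file types the `k`-uniform / log-rate TWINS of the landed target texts through which W(L) is proved (every brick of the chain is a twin of a LANDED file):
* `ValleyGainLogAt L δ η`, `InnerShellGainSmallLogAt L δc δ η`, `ShellGainOneOrbitLogAt L δc δ η` — the gains with LOG RATE: `∀ c, ∃ β₀, ∀ β ≥ β₀`, Rayleigh quotient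
  `≤ e^{−(c·log β)·λ_b(L³β)}·λ₀` on the region (twins of ✓`ValleyGainAt`, ✓`InnerShellGainSmallAt`, ✓`ShellGainOneOrbitAt`); `…_of_log`: each implies its constant-rate text;
* `InnerWindowOneOrbitAt L δ`, `InnerWindowAt L δ` — the `k`-UNIFORM INNER WINDOW (twins of ✓`InnerNoIntruderOneOrbitAt`, ✓`InnerNoIntruderAt`): `∃ θ < 1, ∀ ε > 0, ∃ β₀, ∀ β ≥ β₀,
  ∀ k`, every nondegenerate `(k+1)`-family supported in the inner region has a combination `ψ ≠ 0` with `⟨ψ,K_βψ⟩·μ₀ ≤ (max μ_k (θμ₀) + ελ_b μ₀)·λ₀·‖ψ‖²` (`μ_j` = one-site levels at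
  `B = L³β`; no lower bound on `μ_k` is used or needed — the stiff block caps at `θμ₀`);
* antitonicity in the radius (`valleyGainLogAt_anti`, `innerWindowOneOrbitAt_anti`, `innerWindowAt_anti`).
HONEST FRAMING: target texts (definitions) and bookkeeping only; W(L), `stub_cmpTwoLoop`, `stub_labelTracking` and the crux `TwistedTraceScaling` are OPEN; CONDITIONAL route R2b1
(Lüscher two-lattice reduction); fixed lattice size, eventually in `β`; not infinite volume, not a mass gap, not Clay.  No `sorry`.
-/

set_option autoImplicit false

noncomputable section

open MeasureTheory Filter Topology Real
open scoped BigOperators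
open Literature.MathematicalPhysics.QuantumFieldTheory
open Literature.MathematicalPhysics.QuantumLattice

namespace Summit.QuantumFields.YangMills.Theorems.FemtoTransferGap

variable (L : ℕ) [NeZero L]

/-! ## §1 Gains with LOG RATE -/

/-- **V_log(L) — VALLEY GAIN at scales `(δ, η)` WITH LOG RATE** (target text; OPEN in general, proved for the record scales by the chain of this card).  For every `c`,
eventually in `β`, every physical zero-flux `φ` supported in the valley `{S(U) < 2η(β)} ∩ {∀ z, δ(β)/2 < orbitDist(τ_z U)}` satisfies
`⟨φ, K_β φ⟩ ≤ e^{−(c·log β)·λ_b(L³β)} · λ₀(β, L) · ‖φ‖²`.  The log-rate twin of ✓`ValleyGainAt` (which it implies, `valleyGainAt_of_log`). [cite: Luscher1983, §3] -/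
def ValleyGainLogAt (δ η : ℝ → ℝ) : Prop :=
  ∀ c : ℝ, ∃ β0 : ℝ, ∀ β : ℝ, β0 ≤ β → ∀ φ : GaugeConfig 3 L SU2 → ℝ, IsPhys φ →
    (∀ U, φ U ≠ 0 → wilsonAction su2Rep U < 2 * η β ∧ ∀ z : Fin 3 → Bool, δ β / 2 < orbitDist (TT.twist3 z U)) →
      qform su2Rep β φ φ ≤ Real.exp (-(c * Real.log β * bareLambda ((L : ℝ) ^ 3 * β))) * levelValue su2Rep L β 0 * l2 φ φ

/-- **INNER SHELL GAIN (small action) WITH LOG RATE** at radii `(δc, δ)` below the action threshold `2η` (target text).  For every `c`, eventually in `β`: every physical zero-flux `φ`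
supported in `{S < 2η(β)} ∩ {∃ z, orbitDist(τ_z U) < δ(β)} ∩ {∀ z, δc(β)/2 < orbitDist(τ_z U)}` has `⟨φ, K_β φ⟩ ≤ e^{−(c·log β)·λ_b(L³β)} · λ₀(β, L) · ‖φ‖²`.  Twin of
✓`InnerShellGainSmallAt`. [cite: Luscher1983, §3] -/
def InnerShellGainSmallLogAt (δc δ η : ℝ → ℝ) : Prop :=
  ∀ c : ℝ, ∃ β0 : ℝ, ∀ β : ℝ, β0 ≤ β → ∀ φ : GaugeConfig 3 L SU2 → ℝ, IsPhys φ →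
    (∀ U, φ U ≠ 0 → wilsonAction su2Rep U < 2 * η β ∧ (∃ z : Fin 3 → Bool, orbitDist (TT.twist3 z U) < δ β) ∧
      ∀ z : Fin 3 → Bool, δc β / 2 < orbitDist (TT.twist3 z U)) →
      qform su2Rep β φ φ ≤ Real.exp (-(c * Real.log β * bareLambda ((L : ℝ) ^ 3 * β))) * levelValue su2Rep L β 0 * l2 φ φ

/-- **C4-SHELL at ONE orbit WITH LOG RATE** (target text): for every `c`, eventually in `β`, every bounded measurable GAUGE-invariant `G` supported in
`{S(U) < 2η(β)} ∩ {orbitDist U < δ(β)} ∩ {δc(β)/2 < orbitDist U}` satisfies `⟨G, K_β G⟩ ≤ e^{−(c·log β)·λ_b(L³β)} · λ₀(β, L) · ‖G‖²`.  Twin of ✓`ShellGainOneOrbitAt`.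
[cite: Luscher1983, §3] -/
def ShellGainOneOrbitLogAt (δc δ η : ℝ → ℝ) : Prop :=
  ∀ c : ℝ, ∃ β0 : ℝ, ∀ β : ℝ, β0 ≤ β → ∀ G : GaugeConfig 3 L SU2 → ℝ, Measurable G → (∃ C : ℝ, ∀ U, |G U| ≤ C) →
    (∀ (g : Site 3 L → SU2) (U : GaugeConfig 3 L SU2), G (gaugeTransform g U) = G U) →
    (∀ U, G U ≠ 0 → wilsonAction su2Rep U < 2 * η β ∧ orbitDist U < δ β ∧ δc β / 2 < orbitDist U) →
      qform su2Rep β G G ≤ Real.exp (-(c * Real.log β * bareLambda ((L : ℝ) ^ 3 * β))) * levelValue su2Rep L β 0 * l2 G G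

/-! ## §2 The `k`-UNIFORM inner window -/

/-- **W-INNER₁(L) — the `k`-UNIFORM INNER WINDOW at ONE orbit** (target text; proved for the record radius `β^{−s}`, `1/6 < s < 1/5`, by the chain of this card).  There is `θ < 1`
such that for every `ε > 0`, eventually in `β` (ONE threshold for ALL levels `k`): every family `G₀ … G_k` of bounded measurable GAUGE-invariant functions supported in `{orbitDist U < δ(β)}`
with nondegenerate Gram matrix has a nonzero combination `ψ = Σ aᵢGᵢ` with `⟨ψ,K_βψ⟩·μ₀ ≤ (max μ_k (θ·μ₀) + ε·λ_b(L³β)·μ₀)·λ₀(β,L)·‖ψ‖²` (`μ_j` = one-site levels at `B = L³β`).  The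
`k`-uniform twin of ✓`InnerNoIntruderOneOrbitAt` (Born–Oppenheimer: slow block ≈ one-site min–max at level `k`, stiff block ≤ `θμ₀`, off-diagonal `o(λ_b^{1/2})`). [cite: Luscher1983, §3]
[cite: SjostrandZworski2007, §2] -/
def InnerWindowOneOrbitAt (δ : ℝ → ℝ) : Prop :=
  ∃ θ : ℝ, θ < 1 ∧ ∀ ε : ℝ, 0 < ε → ∃ β0 : ℝ, ∀ β : ℝ, β0 ≤ β → ∀ k : ℕ,
    ∀ G : Fin (k + 1) → (GaugeConfig 3 L SU2 → ℝ),
      (∀ i, Measurable (G i)) → (∀ i, ∃ C : ℝ, ∀ U, |G i U| ≤ C) →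
      (∀ i (g : Site 3 L → SU2) (U : GaugeConfig 3 L SU2), G i (gaugeTransform g U) = G i U) →
      (∀ i U, G i U ≠ 0 → orbitDist U < δ β) →
      (∀ a : Fin (k + 1) → ℝ, a ≠ 0 → 0 < l2 (fun U => ∑ i, a i * G i U) (fun U => ∑ i, a i * G i U)) →
        ∃ a : Fin (k + 1) → ℝ, a ≠ 0 ∧
          qform su2Rep β (fun U => ∑ i, a i * G i U) (fun U => ∑ i, a i * G i U) * levelValue su2Rep 1 ((L : ℝ) ^ 3 * β) 0 ≤
            (max (levelValue su2Rep 1 ((L : ℝ) ^ 3 * β) k) (θ * levelValue su2Rep 1 ((L : ℝ) ^ 3 * β) 0) +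
                ε * bareLambda ((L : ℝ) ^ 3 * β) * levelValue su2Rep 1 ((L : ℝ) ^ 3 * β) 0) * levelValue su2Rep L β 0 *
              l2 (fun U => ∑ i, a i * G i U) (fun U => ∑ i, a i * G i U)

/-- **W-INNER(L) — the `k`-UNIFORM INNER WINDOW, subspace form for physical families in the eight inner neighbourhoods** (target text).  There is `θ < 1` such that for every `ε > 0`,
eventually in `β` (one threshold for all `k`): every family `F₀ … F_k` of physical zero-flux functions supported in `{∃ z, orbitDist(τ_z U) < δ(β)}` with nondegenerate Gram matrix has a
nonzero combination `ψ` with `⟨ψ,K_βψ⟩·μ₀ ≤ (max μ_k (θ·μ₀) + ε·λ_b(L³β)·μ₀)·λ₀(β,L)·‖ψ‖²`.  The `k`-uniform twin of ✓`InnerNoIntruderAt`. [cite: Luscher1983, §3] -/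
def InnerWindowAt (δ : ℝ → ℝ) : Prop :=
  ∃ θ : ℝ, θ < 1 ∧ ∀ ε : ℝ, 0 < ε → ∃ β0 : ℝ, ∀ β : ℝ, β0 ≤ β → ∀ k : ℕ,
    ∀ F : Fin (k + 1) → (GaugeConfig 3 L SU2 → ℝ), (∀ i, IsPhys (F i)) →
      (∀ i U, F i U ≠ 0 → ∃ z : Fin 3 → Bool, orbitDist (TT.twist3 z U) < δ β) →
      (∀ a : Fin (k + 1) → ℝ, a ≠ 0 → 0 < l2 (fun U => ∑ i, a i * F i U) (fun U => ∑ i, a i * F i U)) →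
        ∃ a : Fin (k + 1) → ℝ, a ≠ 0 ∧
          qform su2Rep β (fun U => ∑ i, a i * F i U) (fun U => ∑ i, a i * F i U) * levelValue su2Rep 1 ((L : ℝ) ^ 3 * β) 0 ≤
            (max (levelValue su2Rep 1 ((L : ℝ) ^ 3 * β) k) (θ * levelValue su2Rep 1 ((L : ℝ) ^ 3 * β) 0) +
                ε * bareLambda ((L : ℝ) ^ 3 * β) * levelValue su2Rep 1 ((L : ℝ) ^ 3 * β) 0) * levelValue su2Rep L β 0 *
              l2 (fun U => ∑ i, a i * F i U) (fun U => ∑ i, a i * F i U)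

variable {L}

/-! ## §3 Bookkeeping: the log-rate texts imply the constant-rate texts; antitonicity in the radius -/

/-- A constant rate is eventually below a log rate: for every `A` and `β ≥ max 1 (exp A)`, `e^{−(1·log β)·λ} ≤ e^{−A·λ}` whenever `λ ≥ 0`. [folklore] -/
theorem exp_log_rate_le {A β lam : ℝ} (hβ : max 1 (Real.exp A) ≤ β) (hlam : 0 ≤ lam) :
    Real.exp (-(1 * Real.log β * lam)) ≤ Real.exp (-(A * lam)) := by
  have hβA : Real.exp A ≤ β := (le_max_right _ _).trans hβ
  have hA : A ≤ Real.log β := by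
    have := Real.log_le_log (Real.exp_pos A) hβA
    rwa [Real.log_exp] at this
  refine Real.exp_le_exp.mpr ?_
  have := mul_le_mul_of_nonneg_right hA hlam
  linarith

/-- `λ_b(L³β) ≥ 0` for `β ≥ 1`. [folklore] -/
theorem bareLambda_cube_nonneg {β : ℝ} (hβ : 1 ≤ β) : 0 ≤ bareLambda ((L : ℝ) ^ 3 * β) := by
  have hL1 : (1 : ℝ) ≤ (L : ℝ) ^ 3 := one_le_pow₀ (by exact_mod_cast NeZero.one_le)
  have hB : 0 < (L : ℝ) ^ 3 * β := by nlinarith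
  exact (bareLambda_pos' hB).le

/-- The log-rate valley gain implies the valley gain. [folklore] -/
theorem valleyGainAt_of_log {δ η : ℝ → ℝ} (hV : ValleyGainLogAt L δ η) : ValleyGainAt L δ η := by
  intro A
  obtain ⟨β0, hβ0⟩ := hV 1
  refine ⟨max β0 (max 1 (Real.exp A)), fun β hβ φ hφ hsupp => ?_⟩
  have h1 : max 1 (Real.exp A) ≤ β := (le_max_right _ _).trans hβ
  have hβ1 : 1 ≤ β := (le_max_left _ _).trans h1
  refine (hβ0 β ((le_max_left _ _).trans hβ) φ hφ hsupp).trans ?_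
  exact mul_le_mul_of_nonneg_right (mul_le_mul_of_nonneg_right (exp_log_rate_le h1 (bareLambda_cube_nonneg hβ1)) (levelValue_zero_su2Rep_pos L β).le)
    (l2_self_nonneg_lat _)

/-- The log-rate small-action shell gain implies the small-action shell gain. [folklore] -/
theorem innerShellGainSmallAt_of_log {δc δ η : ℝ → ℝ} (hS : InnerShellGainSmallLogAt L δc δ η) : InnerShellGainSmallAt L δc δ η := by
  intro A
  obtain ⟨β0, hβ0⟩ := hS 1
  refine ⟨max β0 (max 1 (Real.exp A)), fun β hβ φ hφ hsupp => ?_⟩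
  have h1 : max 1 (Real.exp A) ≤ β := (le_max_right _ _).trans hβ
  have hβ1 : 1 ≤ β := (le_max_left _ _).trans h1
  refine (hβ0 β ((le_max_left _ _).trans hβ) φ hφ hsupp).trans ?_
  exact mul_le_mul_of_nonneg_right (mul_le_mul_of_nonneg_right (exp_log_rate_le h1 (bareLambda_cube_nonneg hβ1)) (levelValue_zero_su2Rep_pos L β).le)
    (l2_self_nonneg_lat _)

/-- The log-rate one-orbit shell gain implies the one-orbit shell gain. [folklore] -/
theorem shellGainOneOrbitAt_of_log {δc δ η : ℝ → ℝ} (hS : ShellGainOneOrbitLogAt L δc δ η) : ShellGainOneOrbitAt L δc δ η := by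
  intro A
  obtain ⟨β0, hβ0⟩ := hS 1
  refine ⟨max β0 (max 1 (Real.exp A)), fun β hβ G hGm hGb hGinv hsupp => ?_⟩
  have h1 : max 1 (Real.exp A) ≤ β := (le_max_right _ _).trans hβ
  have hβ1 : 1 ≤ β := (le_max_left _ _).trans h1
  refine (hβ0 β ((le_max_left _ _).trans hβ) G hGm hGb hGinv hsupp).trans ?_
  exact mul_le_mul_of_nonneg_right (mul_le_mul_of_nonneg_right (exp_log_rate_le h1 (bareLambda_cube_nonneg hβ1)) (levelValue_zero_su2Rep_pos L β).le)
    (l2_self_nonneg_lat _)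

/-- A log rate absorbs constant shifts: for `β ≥ max 1 (exp D)` and `λ ≥ 0`, `(c·log β)·λ + D·λ ≤ ((c+1)·log β)·λ` (the form used by the two-zone composition, where each IMS cut
costs a fixed multiple of `λ_b`). [folklore] -/
theorem log_rate_shift {c D β lam : ℝ} (hβ : max 1 (Real.exp D) ≤ β) (hlam : 0 ≤ lam) :
    c * Real.log β * lam + D * lam ≤ (c + 1) * Real.log β * lam := by
  have hβD : Real.exp D ≤ β := (le_max_right _ _).trans hβ
  have hD : D ≤ Real.log β := by
    have := Real.log_le_log (Real.exp_pos D) hβD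
    rwa [Real.log_exp] at this
  have := mul_le_mul_of_nonneg_right hD hlam
  nlinarith

/-- The log-rate valley gain is antitone in the radius: a gain beyond a smaller radius implies the gain beyond a larger one. [folklore] -/
theorem valleyGainLogAt_anti {δ δ' η : ℝ → ℝ} (hle : ∀ β, δ' β ≤ δ β) (hV : ValleyGainLogAt L δ' η) : ValleyGainLogAt L δ η := by
  intro c
  obtain ⟨β0, hβ0⟩ := hV c
  exact ⟨β0, fun β hβ φ hφ hsupp => hβ0 β hβ φ hφ fun U hU => ⟨(hsupp U hU).1, fun z => lt_of_le_of_lt (by linarith [hle β]) ((hsupp U hU).2 z)⟩⟩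

/-- Polynomial radii: `ValleyGainLogAt L (β^{−a'}) η → ValleyGainLogAt L (β^{−a}) η` for `a ≤ a'`. [folklore] -/
theorem valleyGainLogAt_pow_mono {a a' : ℝ} {η : ℝ → ℝ} (haa : a ≤ a') (hV : ValleyGainLogAt L (powScale a') η) : ValleyGainLogAt L (powScale a) η :=
  valleyGainLogAt_anti (fun β => powScale_le_powScale haa β) hV

/-- The one-orbit inner window is antitone in the radius. [folklore] -/
theorem innerWindowOneOrbitAt_anti {δ δ' : ℝ → ℝ} (hle : ∀ β, δ' β ≤ δ β) (hI : InnerWindowOneOrbitAt L δ) : InnerWindowOneOrbitAt L δ' := by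
  obtain ⟨θ, hθ, h⟩ := hI
  refine ⟨θ, hθ, fun ε hε => ?_⟩
  obtain ⟨β0, hβ0⟩ := h ε hε
  exact ⟨β0, fun β hβ k G hGm hGb hGinv hGsupp hGram => hβ0 β hβ k G hGm hGb hGinv (fun i U hU => (hGsupp i U hU).trans_le (hle β)) hGram⟩

/-- The inner window is antitone in the radius. [folklore] -/
theorem innerWindowAt_anti {δ δ' : ℝ → ℝ} (hle : ∀ β, δ' β ≤ δ β) (hI : InnerWindowAt L δ) : InnerWindowAt L δ' := by
  obtain ⟨θ, hθ, h⟩ := hI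
  refine ⟨θ, hθ, fun ε hε => ?_⟩
  obtain ⟨β0, hβ0⟩ := h ε hε
  refine ⟨β0, fun β hβ k F hF hFsupp hGram => hβ0 β hβ k F hF (fun i U hU => ?_) hGram⟩
  obtain ⟨z, hz⟩ := hFsupp i U hU
  exact ⟨z, hz.trans_le (hle β)⟩

/-- The window coefficient is at most `(1 + ελ_b)·μ₀`: `max μ_k (θμ₀) + ελ_bμ₀ ≤ μ₀ + ελ_bμ₀` for `θ ≤ 1` (`μ_k ≤ μ₀`, `B > 0`). [folklore] -/
theorem window_coeff_le {B θ ε : ℝ} (hB : 0 < B) (hθ : θ ≤ 1) (k : ℕ) :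
    max (levelValue su2Rep 1 B k) (θ * levelValue su2Rep 1 B 0) + ε * bareLambda B * levelValue su2Rep 1 B 0 ≤
      levelValue su2Rep 1 B 0 + ε * bareLambda B * levelValue su2Rep 1 B 0 := by
  have hμ0 : 0 < levelValue su2Rep 1 B 0 := levelValue_su2Rep_pos (L := 1) hB 0
  have h1 : levelValue su2Rep 1 B k ≤ levelValue su2Rep 1 B 0 := levelValue_le_of_le (L := 1) hB (Nat.zero_le k)
  have h2 : θ * levelValue su2Rep 1 B 0 ≤ levelValue su2Rep 1 B 0 := by nlinarith
  linarith [max_le h1 h2]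

end Summit.QuantumFields.YangMills.Theorems.FemtoTransferGap

end
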